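import Summits.BirchSwinnertonDyer.BirchSwinnertonDyer.Theorems.KatoDescentTamePotSupersingularTameLowerVisibilityNn
import Summits.BirchSwinnertonDyer.BirchSwinnertonDyer.Theorems.Rank2ObservatoryKernelWalker
import Summits.BirchSwinnertonDyer.Rank1Residual.X4.VisibilityRankOneFreePlaces
import Summits.BirchSwinnertonDyer.Rank1Residual.GaloisImage.PadicTwistClassDecider
import Literature.NumberTheory.GaloisRepresentations.LocalH2VanishingTrivialModule
import Literature.NumberTheory.GaloisRepresentations.TateLevelOneLocalGenerators
import HarnessLib

/-!
# Route `KatoDescentTamePotSupersingular` (rung K8-t′, cell `bsd-potss`), open core `TameLowerIntrinsicNonCM`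
# (item stmt-BirchSwinnertonDyer-19618), registered stub `stub_intr_kuriharaCerts_offSeed` — FOUR rows of the
# Kurihara lane's RESIDUE at `p = 5`: L₀ PER CLASS by VISIBILITY from a `5`-congruent RANK-2 curve of the same conductor —
# FILE 01 of 2: shared plumbing, `244800sz1`, `126350do1` (a `--supports … --as helper` file; seat `bsd-potss-k8t-c2` generation 8)

PARTITION (D-0054, cell bsd-potss): EXCLUDED-DOMAIN non-CM additive `p` · B4 (t′) (`e ∈ {3,4,6}`), `r_an = 0`, LOWER half
L₀ — harvests-a-certificate with the cell's visibility instrument (kt-pdesc g2, `…TameLowerVisibilityNn.lean`) on the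
residue of the Kurihara lane (kt-kur5 g0: 260 / 278 off-seed intrinsic non-CM surjective (t′) rank-`0` rows at `p ≥ 5`
certified; 18 uncertified); closes NONE; shrinks-literal none; books nothing.

Of the 18 uncertified rows, FOUR have a `5`-CONGRUENT curve `F` of RANK `2` AND OF THE SAME CONDUCTOR (seat k8t-c2 g7's
screen `VIS-SCREEN-tprime-p5plus-k8t-c2-g7.tsv`; kit j262735 of this seat: kt-pdesc g2's engines A = `scan.gp` (PARI/GP,
Kraus–Oesterlé 1992 Prop. 4 VERBATIM on every Cremona curve of the conductor surviving a 60-prime mod-`5` screen, exact local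
`5`-torsion counts) and B = `engineB.py` (PARI-free point counts) — evidence HOME/k8t-c2/g8/):

| `W` (target, `#Ш_an = 25`, tors `1`, Kodaira at `5`) | `F` (rank `2`, kernel) | `S` | the one place of `S` with `F(ℚ_w)[5] ≠ 0` | road |
|---|---|---|---|---|
| `244800sz1` `[0,0,0,19540500,-5398670000]` (`IV*`) | `244800f1` `[0,0,0,-619500,-171790000]` | `{2,3,5,17}` | none | simple count §2 |
| `126350do1` `[1,-1,1,-1606302780,-24778909622453]` (`IV`) | `126350dn1` `[1,0,0,-22988,2126992]` | `{2,5,7,19}` | `7` (both `I₅`) | free place §3 |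
| `492450fq1` `[1,1,1,-1336180553513,-594487844304328969]` (`IV*`) | `492450es1` `[1,1,1,-12888,5812281]` | `{2,3,5,7,67}` | `2` (both `I₅`) | free place, FILE 02 §4 |
| `201150f1` `[1,-1,1,-115603241180,-15128723997763553]` (`IV*`) | `201150c1` `[1,-1,1,-28055,3766447]` | `{2,3,5,149}` | `149` (`I₂` / `I₁`) | free place, FILE 02 §5 |

ROADS (all in the tree; nothing is restated, no named fact is minted):
* §2 — the kernel count `WeierstrassCurve.exists_sha_ne_zero_of_congr_of_rank` (`CongruenceVisibilityLocalFactors.lean`: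
  Cremona–Mazur 2000 §3 / Agashe–Stein 2002 Thm. 3.1 PROVED from the tree's Galois cohomology, NO condition at `p`): every
  place of `S` of kind (i) (`F(ℚ_w)[5] = 0`, x10b's decider `fiveTorsionCheckAt`, kernel), `rank F ≥ 2 = rank W + [ℚ:ℚ] + 1`;
* §3 (and FILE 02 §§4–5) — the count WITH FREE PLACES `X4.exists_sha_ne_zero_of_congr_of_rank_add_of_freePlaces` (x11c gen 25,
  `X4/VisibilityRankOneFreePlaces.lean` §1, ANY rank): the one multiplicative place `w` of `S` where `F(ℚ_w)[5] ≅ ℤ/5` is of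
  KIND (iii′) — `|j(W)|_w > 1`, `|j(F)|_w > 1`, the twist classes `γ = −c₄/c₆` agree up to a square in `ℚ_w` (p17's decider
  `sqFlagAt`, kernel), `μ₅(ℚ_w) = 1` (`5 ∤ w(w−1)`, kernel) — hence FREE (comparison index `1`) by Tate's uniformisation, the ONE
  extra published binder `hU2` (`Silverman1994_thmV53_corV54_tateUniformisation`, Silverman ATAEC V.5.3 / Cor. 5.4); the other
  places are of kind (i) (decider, kernel);
* then Cassels–Tate squareness (`missingLowerBoundAt_of_casselsTate_of_pow_dvd`, `hCT`) and GZK (`hGZK`: `W(ℚ)`, `Ш(W)` finite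
  and `rank W = 0` at analytic rank `0`): `Ш(W)[5] ≠ 0 ⇒ 25 ∣ #Ш(W) ⇒ ord₅ #Ш ≥ 2 = ord₅ #Ш_an`.

KERNEL (this file and FILE 02): `Δ ≠ 0` of the four partners, `W[5]` irreducible for the four targets (Frobenius witnesses `ℓ = 7, 3, 17, 7`),
good reduction of both curves of each pair outside `S` (discriminant supports), `#F(ℚ_w)[5] = 1` at every kind-(i) place
(decider certificates, all with `S = 0`), `2 ≤ rank F(ℚ)` for the four partners (the rank-≥2 observatory's certificate CHECK
`two_le_mordellWeilRank_of_certCheck` evaluated on the observatory's own certificate rows — walker lists W48b5 / W25a3 / W98a6 /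
W40a3 — by `decide +kernel`; no hypothesis), the kind-(iii′) numerals at `7`, `2`, `149`.  BINDERS: `hCT`, `hGZK` (+ `hU2` in
§3 / FILE 02); Cremona's `r_an = 0` and `#Ш_an` (`hr0`, `hq`, `hv`); the `Γ_ℚ`-isomorphism `θ : F[5] ⥲ W[5]` (evidence tier, as in every
visibility record of the tree: Kraus–Oesterlé to the printed bound, two engines, kit j262735; `W[5]` irreducible in the kernel).
HONEST LABEL: per-class certificates modulo Cassels–Tate + GZK (+ Tate uniformisation) and the displayed data; the stub and the
item stay OPEN (class-wide = Kurihara's conjecture / Kato Conj. 12.10 lower inclusion at an additive potentially supersingular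
prime); nothing is booked; BSD is not proved by any of this.  After this file the Kurihara-lane residue at `p ≥ 5` on the census
universe (`N < 5·10⁵`) is 18 → 14 rows (list: HOME/kt-kur5/KT-KURIHARA-OFFSEED-CENSUS-kt-kur5-g0.md §RESIDUE).

References: [CremonaMazur2000] §3, Table 1; [AgasheStein2002] Thm. 3.1; [KrausOesterle1992] Prop. 4; [SilvermanAEC2009]
VII.3.1(b), VII.5 Prop. 5.1(a), VIII.6.7, X.4.14; [SilvermanATAEC1994] V Lemma 5.2 (c), Thm. 5.3, Cor. 5.4; [Mazur1978]
Prop. 6.3; [Kato2004Asterisque] Conj. 12.10; [Kurihara2014b] Thm. B; [Cremona2006] Table 1.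
-/

set_option autoImplicit false
-- sibling precedent (`KatoDescentTamePotSupersingularTameLowerVisibilityNn.lean`): the directory name repeats the summit name
set_option linter.dupNamespace false

noncomputable section

open scoped Classical

open WeierstrassCurve Literature.NumberTheory.EllipticCurves
  Literature.NumberTheory.EllipticCurves.Rank1Residual
  Literature.NumberTheory.EllipticCurves.Rank1Residual.Typed
  Literature.NumberTheory.EllipticCurves.Rank1Residual.X11RankOneCertificates
  Summit.BirchSwinnertonDyer.BirchSwinnertonDyer.Rank1Residual.IntModel
  Summit.BirchSwinnertonDyer.BirchSwinnertonDyer.Rank1Residual.X11RankOne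
  Summit.BirchSwinnertonDyer.BirchSwinnertonDyer.Rank2Observatory
  Summit.BirchSwinnertonDyer.Rank1Residual.X11b
  Summit.BirchSwinnertonDyer.Rank1Residual.GaloisImage
  Summit.BirchSwinnertonDyer.Rank1Residual.Supersingular
  Summit.BirchSwinnertonDyer.Rank1Residual.Supersingular.LocalOddTorsion
open NumberField IsDedekindDomain Rat.HeightOneSpectrum

namespace Summit.BirchSwinnertonDyer.BirchSwinnertonDyer.Theorems.KTVis

/-! ## §1 Shared plumbing: the finite set of places named by a prime list (no definition is introduced; the set is the
literal `filterMap` image, as in `…TameLowerVisibilityNn.lean`) -/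

/-- Membership in the set of places named by a list of primes is membership of the residue characteristic in the list.
[folklore] -/
theorem mem_placesOfList_iff {L : List ℕ} (hL : ∀ r ∈ L, r.Prime) (w : HeightOneSpectrum (𝓞 ℚ)) :
    w ∈ (L.filterMap fun r ↦ if h : r.Prime then some ((primesEquiv (R := 𝓞 ℚ)).symm ⟨r, h⟩) else none).toFinset ↔
      (primesEquiv w : ℕ) ∈ L := by
  rw [List.mem_toFinset, List.mem_filterMap]
  constructor
  · rintro ⟨r, hr, hrw⟩
    rw [dif_pos (hL r hr), Option.some.injEq] at hrw
    rw [← hrw, Equiv.apply_symm_apply]; exact hr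
  · intro hw
    refine ⟨(primesEquiv w : ℕ), hw, ?_⟩
    rw [dif_pos (primesEquiv w).2]; simp

/-- **Good reduction of a pair outside the places of a prime list containing both discriminant supports, and `5` among
them.** [cite: SilvermanAEC2009, VII.5 Prop. 5.1(a)] -/
theorem good_outside_placesOfList {L : List ℕ} (hL : ∀ r ∈ L, r.Prime) (h5 : 5 ∈ L)
    (a₁ a₂ a₃ a₄ a₆ b₁ b₂ b₃ b₄ b₆ : ℤ)
    (hΔE : ∀ r : ℕ, r.Prime → (r : ℤ) ∣ (⟨a₁, a₂, a₃, a₄, a₆⟩ : WeierstrassCurve ℤ).Δ → r ∈ L)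
    (hΔF : ∀ r : ℕ, r.Prime → (r : ℤ) ∣ (⟨b₁, b₂, b₃, b₄, b₆⟩ : WeierstrassCurve ℤ).Δ → r ∈ L)
    (W F : WeierstrassCurve ℚ) (hWeq : W = ⟨a₁, a₂, a₃, a₄, a₆⟩) (hFeq : F = ⟨b₁, b₂, b₃, b₄, b₆⟩) :
    ∀ w : HeightOneSpectrum (𝓞 ℚ),
      w ∉ (L.filterMap fun r ↦ if h : r.Prime then some ((primesEquiv (R := 𝓞 ℚ)).symm ⟨r, h⟩) else none).toFinset →
      W.HasGoodReductionAt w ∧ F.HasGoodReductionAt w ∧ ((5 : ℕ) : 𝓞 ℚ) ∉ w.asIdeal := by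
  intro w hwS
  have hwL : (primesEquiv w : ℕ) ∉ L := fun h ↦ hwS ((mem_placesOfList_iff hL w).mpr h)
  have hqp : (primesEquiv w : ℕ).Prime := (primesEquiv w).2
  refine ⟨?_, ?_, natCast_not_mem_of_primesEquiv_ne w Fact.out fun h ↦ hwL (h ▸ h5)⟩
  · rw [hWeq]
    exact hasGoodReductionAt_mk_of_primesEquiv _ _ _ _ _ w rfl fun h ↦ hwL (hΔE _ hqp (by exact_mod_cast h))
  · rw [hFeq]
    exact hasGoodReductionAt_mk_of_primesEquiv _ _ _ _ _ w rfl fun h ↦ hwL (hΔF _ hqp (by exact_mod_cast h))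

/-- **The last step of every record**: a visible `c ∈ Ш(W)[5] ∖ 0` plus Cassels–Tate (`hCT`) and GZK finiteness at analytic
rank `0` give `MissingLowerBoundAt W 5` as soon as `ord₅ #Ш_an ≤ 2`. [cite: SilvermanAEC2009, Thm. X.4.14] -/
theorem missingLower5_of_visible (hCT : exists_casselsTate_pairing (K := ℚ))
    (hGZK : rank_eq_analyticRank_of_analyticRank_le_one)
    (W : WeierstrassCurve ℚ) [W.IsElliptic] (hr0 : W.analyticRank = 0) {q : ℚ} (hq : shaAn W = (q : ℂ))
    (hv : padicValRat 5 q ≤ 2) (hc : ∃ c : W.sha, c ≠ 0 ∧ (5 : ℕ) • c = 0) : MissingLowerBoundAt W 5 := by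
  haveI : Fact (Nat.Prime 5) := ⟨by norm_num⟩
  have hfinSha : W.ShaFinite := (hGZK W (by rw [hr0]; norm_num)).2
  exact missingLowerBoundAt_of_casselsTate_of_pow_dvd W 5 hCT hfinSha hq (k := 1) (by simpa using hv)
    (by simpa using dvd_shaOrder_of_exists_torsion W 5 hc)

/-! ## §2 `244800sz1 @ 5` ← the rank-`2` curve `244800f1` (simple count; every place of kind (i)) -/

/-- **`2 ≤ rank_ℤ F(ℚ)` for `F = 244800f1` in the kernel**: the rank-≥2 observatory's certificate row (walker list W48b5,
segment 11: points `(-550, 1600)`, `(2650, 129600)`, sum `(-500, -3600)`, killers `(7, 13)`, `(11, 11)`, `t = 1`, witnesses at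
`41, 13, 13`) re-checked here by ONE `decide +kernel` of `Cert.check`. [cite: SilvermanAEC2009, Thm. VIII.6.7]
[cite: Cremona2006, Table 1 (label 244800f1)] -/
theorem two_le_rank_c244800f1 :
    2 ≤ ((⟨0, 0, 0, -619500, -171790000⟩ : WeierstrassCurve ℤ).map (Int.castRingHom ℚ)).mordellWeilRank :=
  two_le_mordellWeilRank_of_certCheck _
    (.odd ⟨-550, 1600, 2650, 129600, -500, -3600, [(7, 13), (11, 11)], 1, 41, 13, 13, 24, 1, 11, 3, 7, 1⟩)
    (by decide +kernel)

/-- **L₀ at `5` for `244800sz1` by VISIBILITY** (`N = 244800 = 2⁵·3²·5²·17`, (t′) at `5`: Kodaira `IV*`, `e = 3`; `ρ̄_{W,5}`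
onto; `r_an = 0`, `#Ш_an = 25`, torsion `1`, `∏ c_ℓ = 2`; single-curve class; kt-kur5 residue «pass-2 timeout»):
`MissingLowerBoundAt W 5` from Cassels–Tate (`hCT`), GZK (`hGZK`), Cremona's `r_an = 0` / `#Ш_an` (`hr0`, `hq`, `hv`) and a
`Γ_ℚ`-isomorphism `θ : F[5] ⥲ W[5]` from the RANK-2 curve `F = 244800f1` of the same conductor (Kraus–Oesterlé mod `5` to the
printed bound, two engines, kit j262735).  KERNEL: `W[5]` irreducible (`ℓ = 7`, `#W̃(𝔽₇) = 3`, `X² − 5X + 7` rootless mod `5`),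
`S = {2, 3, 5, 17}` with good reduction outside (`|Δ_W| = 2²²3⁶5⁸17⁷`, `|Δ_F| = 2²¹3¹¹5⁸17`), `#F(ℚ_w)[5] = 1` at `w = 2, 3, 5, 17`
(decider; at `3` a depth-`25` census with two isolated root balls of non-square ordinate), `2 ≤ rank F(ℚ)`
(`two_le_rank_c244800f1`); count `[W:5W]·∏_{w∈S} #𝓛_w(F) = 1·5 < 25 ≤ [F:5F]` (`exists_sha_ne_zero_of_congr_of_rank`), so
`Ш(W)[5] ≠ 0` and `ord₅ #Ш ≥ 2 = ord₅ #Ш_an`.  Per class; stub / item NOT closed; nothing booked.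
[cite: CremonaMazur2000, §3 and Table 1] [cite: AgasheStein2002, Thm. 3.1] [cite: KrausOesterle1992, Prop. 4]
[cite: Mazur1978, Prop. 6.3 (1)] [cite: SilvermanAEC2009, VII.5 Prop. 5.1(a), Thm. X.4.14] [cite: Cremona2006, Table 1 (labels 244800sz1, 244800f1)] -/
theorem missingLower5_vis_244800sz1 (hCT : exists_casselsTate_pairing (K := ℚ))
    (hGZK : rank_eq_analyticRank_of_analyticRank_le_one)
    (W : WeierstrassCurve ℚ) [W.IsElliptic] [W.IsGloballyMinimal] (hWeq : W = ⟨0, 0, 0, 19540500, -5398670000⟩)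
    (hr0 : W.analyticRank = 0) {q : ℚ} (hq : shaAn W = (q : ℂ)) (hv : padicValRat 5 q ≤ 2)
    (F : WeierstrassCurve ℚ) (hFeq : F = ⟨0, 0, 0, -619500, -171790000⟩)
    (θ : geomTorsion F (5 : ℤ) ≃+ geomTorsion W (5 : ℤ))
    (hθ : ∀ (σ : Field.absoluteGaloisGroup ℚ) (P : geomTorsion F (5 : ℤ)), θ (σ • P) = σ • θ P) :
    MissingLowerBoundAt W 5 := by
  haveI hFell : F.IsElliptic := by
    rw [hFeq]
    exact Summit.BirchSwinnertonDyer.Rank1Residual.X11b.isElliptic_of_discOf_ne_zero 0 0 0 (-619500) (-171790000)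
      (by decide +kernel)
  have hIW : integralModelInt W = ⟨0, 0, 0, 19540500, -5398670000⟩ :=
    integralModelInt_eq_of_map_eq _ (by rw [hWeq]; exact map_mk_int 0 0 0 19540500 (-5398670000))
  -- `W[5]` irreducible: Frobenius witness at `ℓ = 7` (`#W̃(𝔽₇) = 3`, `a₇ = 5`)
  have hirr : Irr W 5 :=
    hasIrreducibleModPGaloisRep_of_intModel_of_noroot hIW 5 7 (by norm_num) (by decide +kernel)
      (natCard_point_eq_of_countPoints 0 0 0 19540500 (-5398670000) 7 (by norm_num)
        (by decide +kernel) (n := 3) (by decide +kernel)) (by decide)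
  haveI hfin : Finite W.toAffine.Point := finite_point_of_analyticRank_eq_zero W hGZK hr0
  have hcop : (Nat.card W.toAffine.Point).Coprime 5 := coprime_natCard_point_of_irr W 5 hirr
  have hrank : Module.finrank ℚ ℚ + 1 ≤ F.mordellWeilRank := by
    have h2 := two_le_rank_c244800f1
    have hE : (⟨0, 0, 0, -619500, -171790000⟩ : WeierstrassCurve ℤ).map (Int.castRingHom ℚ) =
        (⟨0, 0, 0, -619500, -171790000⟩ : WeierstrassCurve ℚ) := by
      ext <;> simp [WeierstrassCurve.map]
    rw [hE] at h2
    rw [Module.finrank_self, hFeq]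
    exact h2
  have h2 : ∀ w : HeightOneSpectrum (𝓞 ℚ), (primesEquiv w : ℕ) = 2 →
      Nat.card (nsmulAddMonoidHom 5 : (F.baseChange (w.adicCompletion ℚ)).toAffine.Point →+ _).ker = 1 :=
    fun w hw ↦
      natCard_ker_nsmul_five_adicCompletion_eq_one_of_checkAt 2 0 0 0 (-619500) (-171790000) (by decide +kernel)
        (k := 5) (cert := []) (by decide +kernel) F hFeq hw
  have h3 : ∀ w : HeightOneSpectrum (𝓞 ℚ), (primesEquiv w : ℕ) = 3 →
      Nat.card (nsmulAddMonoidHom 5 : (F.baseChange (w.adicCompletion ℚ)).toAffine.Point →+ _).ker = 1 :=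
    fun w hw ↦
      natCard_ker_nsmul_five_adicCompletion_eq_one_of_checkAt 3 0 0 0 (-619500) (-171790000) (by decide +kernel)
        (k := 25) (cert := [(27722895179780501467, 20, 41, 5), (200119968693116860780528, 24, 49, 7)])
        (by decide +kernel) F hFeq hw
  have h5 : ∀ w : HeightOneSpectrum (𝓞 ℚ), (primesEquiv w : ℕ) = 5 →
      Nat.card (nsmulAddMonoidHom 5 : (F.baseChange (w.adicCompletion ℚ)).toAffine.Point →+ _).ker = 1 :=
    fun w hw ↦
      natCard_ker_nsmul_five_adicCompletion_eq_one_of_checkAt 5 0 0 0 (-619500) (-171790000) (by decide +kernel)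
        (k := 2) (cert := []) (by decide +kernel) F hFeq hw
  have h17 : ∀ w : HeightOneSpectrum (𝓞 ℚ), (primesEquiv w : ℕ) = 17 →
      Nat.card (nsmulAddMonoidHom 5 : (F.baseChange (w.adicCompletion ℚ)).toAffine.Point →+ _).ker = 1 :=
    fun w hw ↦
      natCard_ker_nsmul_five_adicCompletion_eq_one_of_checkAt 17 0 0 0 (-619500) (-171790000) (by decide +kernel)
        (k := 1) (cert := []) (by decide +kernel) F hFeq hw
  set L : List ℕ := [2, 3, 5, 17] with hL
  have hLp : ∀ r ∈ L, r.Prime := by decide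
  have hΔE : ∀ r : ℕ, r.Prime → (r : ℤ) ∣ (⟨0, 0, 0, 19540500, -5398670000⟩ : WeierstrassCurve ℤ).Δ → r ∈ L :=
    forall_mem_of_natAbs_eq_prod_pow L [22, 6, 8, 7] hLp (by decide +kernel)
  have hΔF : ∀ r : ℕ, r.Prime → (r : ℤ) ∣ (⟨0, 0, 0, -619500, -171790000⟩ : WeierstrassCurve ℤ).Δ → r ∈ L :=
    forall_mem_of_natAbs_eq_prod_pow L [21, 11, 8, 1] hLp (by decide +kernel)
  set S : Finset (HeightOneSpectrum (𝓞 ℚ)) :=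
    (L.filterMap fun r ↦ if h : r.Prime then some ((primesEquiv (R := 𝓞 ℚ)).symm ⟨r, h⟩) else none).toFinset
    with hSdef
  have hS := good_outside_placesOfList hLp (by decide) _ _ _ _ _ _ _ _ _ _ hΔE hΔF W F hWeq hFeq
  have hloc : ∀ w ∈ S, Nat.card (nsmulAddMonoidHom 5 :
      (F.baseChange (w.adicCompletion ℚ)).toAffine.Point →+ _).ker = 1 := by
    intro w hwS
    have hwL : (primesEquiv w : ℕ) ∈ L := (mem_placesOfList_iff hLp w).mp hwS
    have hcases : (primesEquiv w : ℕ) = 2 ∨ (primesEquiv w : ℕ) = 3 ∨ (primesEquiv w : ℕ) = 5 ∨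
        (primesEquiv w : ℕ) = 17 := by
      simp only [hL, List.mem_cons, List.mem_nil_iff, or_false] at hwL
      omega
    rcases hcases with hw | hw | hw | hw
    · exact h2 w hw
    · exact h3 w hw
    · exact h5 w hw
    · exact h17 w hw
  exact missingLower5_of_visible hCT hGZK W hr0 hq hv
    (WeierstrassCurve.exists_sha_ne_zero_of_congr_of_rank W F (by norm_num) θ hθ S hS hfin hcop hrank hloc)

/-! ## §3 `126350do1 @ 5` ← the rank-`2` curve `126350dn1`; the place `7` FREE (kind (iii′)) -/

/-- **`2 ≤ rank_ℤ F(ℚ)` for `F = 126350dn1` in the kernel**: the rank-≥2 observatory's certificate row (walker list W25a3, segment 8: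
points `(112, 924)`, `(-84, 1904)`, sum `(-8, -1516)`, killers `(3, 6)`, `(13, 17)`, `t = 1`, witnesses at `3, 11, 3`) re-checked here by ONE `decide +kernel` of `Cert.check`.
[cite: SilvermanAEC2009, Thm. VIII.6.7] [cite: Cremona2006, Table 1 (label 126350dn1)] -/
theorem two_le_rank_c126350dn1 :
    2 ≤ ((⟨1, 0, 0, -22988, 2126992⟩ : WeierstrassCurve ℤ).map (Int.castRingHom ℚ)).mordellWeilRank :=
  two_le_mordellWeilRank_of_certCheck _
    (.odd ⟨112, 924, -84, 1904, -8, -1516, [(3, 6), (13, 17)], 1, 3, 11, 3, 1, 0, 4, 1, 1, 2⟩)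
    (by decide +kernel)

/-- **Kind (iii′) at the place of `7` for `126350do1 ~ 126350dn1`, `p = 5`, in the kernel** (both `I₅` (split for `F`, `c₇(F) = 5`) at `7`): both
`j`-invariants have `7 ∣ den` (`j(W) = 2272707362766267675/67228`, `j(F) = -313391806675/275365888`), the twist classes
`γ = −c₄/c₆` agree up to a square in `ℚ₇` (`γ(W)/γ(F) = -30547096729/5088344593743`, a `7`-adic unit with
`sqFlagAt 7 (N·D) 0 = true`), and `μ₅(ℚ₇) = 1` (`5 ∤ 7`, `5 ∤ 6`). [cite: SilvermanATAEC1994, Ch. V Lemma 5.2 (c), Thm. 5.3, Cor. 5.4]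
[cite: NeukirchANT1999, II §5 Prop. (5.3) and (5.7)] -/
theorem kindIIIPrime_v126350do1_at7 (W W' : WeierstrassCurve ℚ) [W.IsElliptic] [W'.IsElliptic]
    (hW : W = ⟨1, -1, 1, -1606302780, -24778909622453⟩) (hW' : W' = ⟨1, 0, 0, -22988, 2126992⟩)
    {v : HeightOneSpectrum (𝓞 ℚ)} (hv : (primesEquiv v : ℕ) = 7) :
    1 < v.valuation ℚ W.j ∧ 1 < v.valuation ℚ W'.j ∧
      (∃ r : v.adicCompletion ℚ, algebraMap ℚ (v.adicCompletion ℚ) (-(W.c₄ / W.c₆)) =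
        r ^ 2 * algebraMap ℚ (v.adicCompletion ℚ) (-(W'.c₄ / W'.c₆))) ∧
      (∀ ζ : v.adicCompletion ℚ, ζ ^ 5 = 1 → ζ = 1) := by
  haveI : Fact (Nat.Prime 7) := ⟨by norm_num⟩
  haveI : Fact (Nat.Prime 5) := ⟨by norm_num⟩
  have hj : W.j = 2272707362766267675 / 67228 := by
    rw [WeierstrassCurve.j_eq_c₄_pow_three_div_Δ]; subst hW
    norm_num [WeierstrassCurve.c₄, WeierstrassCurve.Δ, WeierstrassCurve.b₂, WeierstrassCurve.b₄,
      WeierstrassCurve.b₆, WeierstrassCurve.b₈]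
  have hj' : W'.j = -313391806675 / 275365888 := by
    rw [WeierstrassCurve.j_eq_c₄_pow_three_div_Δ]; subst hW'
    norm_num [WeierstrassCurve.c₄, WeierstrassCurve.Δ, WeierstrassCurve.b₂, WeierstrassCurve.b₄,
      WeierstrassCurve.b₆, WeierstrassCurve.b₈]
  have hA : -(W.c₄ / W.c₆) = -149881 / 41617971279 := by
    subst hW
    norm_num [WeierstrassCurve.c₄, WeierstrassCurve.c₆, WeierstrassCurve.b₂, WeierstrassCurve.b₄,
      WeierstrassCurve.b₆]
  have hB : -(W'.c₄ / W'.c₆) = 2323 / 3872371 := by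
    subst hW'
    norm_num [WeierstrassCurve.c₄, WeierstrassCurve.c₆, WeierstrassCurve.b₂, WeierstrassCurve.b₄,
      WeierstrassCurve.b₆]
  refine ⟨TwistedKummer.one_lt_valuation_of_eq_of_dvd_den v hv hj (by norm_num) (by decide +kernel),
    TwistedKummer.one_lt_valuation_of_eq_of_dvd_den v hv hj' (by norm_num) (by decide +kernel), ?_, ?_⟩
  · rw [hA, hB]
    exact LocalTorsion3At.exists_eq_sq_mul_of_sqFlagAt v hv (by norm_num) (D := 5088344593743)
      (by norm_num) (N := -30547096729) (by norm_num) (w := 0) (by norm_num) (by decide +kernel)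
      (by decide +kernel)
  · have hcard : Literature.NumberTheory.GaloisRepresentations.IsNonarchimedeanLocalField.residueFieldCard
        (v.adicCompletion ℚ) = 7 :=
      Literature.NumberTheory.GaloisRepresentations.residueFieldCard_adicCompletion_rat 7 v hv
    exact Literature.NumberTheory.GaloisRepresentations.forall_pow_eq_one_imp_eq_one_of_not_dvd
      (F := v.adicCompletion ℚ) (p := 5) (by rw [hcard]; norm_num) (by rw [hcard]; norm_num)


/-- **L₀ at `5` for `126350do1` by VISIBILITY, FREE PLACE `7`** (`N = 126350 = 2·5²·7·19²`, (t′) at `5`: Kodaira `IV`,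
`e = 3`; `ρ̄_{W,5}` onto; `r_an = 0`, `#Ш_an = 25`, torsion `1`, `∏ c_ℓ = 20`; single-curve class; kt-kur5 residue «k = 2 Tamagawa row: Kolyvagin primes `ℓ ≡ 1 (25)`, pair levels out of reach»):
`MissingLowerBoundAt W 5` from Cassels–Tate (`hCT`), GZK (`hGZK`), Tate's uniformisation (`hU2`), Cremona's `r_an = 0` /
`#Ш_an` (`hr0`, `hq`, `hv`) and a `Γ_ℚ`-isomorphism `θ : F[5] ⥲ W[5]` from the RANK-2 curve `F = 126350dn1` of the same conductor
(Kraus–Oesterlé mod `5` to the printed bound, two engines, kit j262735).  KERNEL: `W[5]` irreducible (`ℓ = 3`,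
`#W̃(𝔽₃) = 1`, `X² − 3X + 3` rootless mod `5`), `S = {2, 5, 7, 19}` with good reduction outside (`|Δ_W| = 2²5⁴7⁵19⁹`,
`|Δ_F| = 2¹⁴5⁴7⁵19³`), kind (i) at `2`, `5`, `19` (`#F(ℚ_w)[5] = 1`, decider), kind (iii′) at `7`
(`kindIIIPrime_v126350do1_at7`), `2 ≤ rank F(ℚ)` (`two_le_rank_c126350dn1`), `rank W = 0` (GZK); the free-place count
`X4.exists_sha_ne_zero_of_congr_of_rank_add_of_freePlaces` gives `Ш(W)[5] ≠ 0`, hence `ord₅ #Ш ≥ 2 = ord₅ #Ш_an`.  Per class;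
stub / item NOT closed; nothing booked.
[cite: CremonaMazur2000, §3 and Table 1] [cite: AgasheStein2002, Thm. 3.1] [cite: KrausOesterle1992, Prop. 4]
[cite: SilvermanATAEC1994, Ch. V Thm. 5.3, Cor. 5.4] [cite: Mazur1978, Prop. 6.3 (1)]
[cite: SilvermanAEC2009, VII.5 Prop. 5.1(a), Thm. X.4.14] [cite: Cremona2006, Table 1 (labels 126350do1, 126350dn1)] -/
theorem missingLower5_vis_126350do1 (hCT : exists_casselsTate_pairing (K := ℚ))
    (hGZK : rank_eq_analyticRank_of_analyticRank_le_one)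
    (hU2 : Silverman1994_thmV53_corV54_tateUniformisation.{0})
    (W : WeierstrassCurve ℚ) [W.IsElliptic] [W.IsGloballyMinimal] (hWeq : W = ⟨1, -1, 1, -1606302780, -24778909622453⟩)
    (hr0 : W.analyticRank = 0) {q : ℚ} (hq : shaAn W = (q : ℂ)) (hv : padicValRat 5 q ≤ 2)
    (F : WeierstrassCurve ℚ) (hFeq : F = ⟨1, 0, 0, -22988, 2126992⟩)
    (θ : geomTorsion F (5 : ℤ) ≃+ geomTorsion W (5 : ℤ))
    (hθ : ∀ (σ : Field.absoluteGaloisGroup ℚ) (P : geomTorsion F (5 : ℤ)), θ (σ • P) = σ • θ P) :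
    MissingLowerBoundAt W 5 := by
  haveI hFell : F.IsElliptic := by
    rw [hFeq]
    exact Summit.BirchSwinnertonDyer.Rank1Residual.X11b.isElliptic_of_discOf_ne_zero 1 0 0 (-22988) 2126992
      (by decide +kernel)
  have hIW : integralModelInt W = ⟨1, -1, 1, -1606302780, -24778909622453⟩ :=
    integralModelInt_eq_of_map_eq _ (by rw [hWeq]; exact map_mk_int 1 (-1) 1 (-1606302780) (-24778909622453))
  -- `W[5]` irreducible: Frobenius witness at `ℓ = 3` (`#W̃(𝔽₃) = 1`, `a = 3`)
  have hirr : Irr W 5 :=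
    hasIrreducibleModPGaloisRep_of_intModel_of_noroot hIW 5 3 (by norm_num) (by decide +kernel)
      (natCard_point_eq_of_countPoints 1 (-1) 1 (-1606302780) (-24778909622453) 3 (by norm_num)
        (by decide +kernel) (n := 1) (by decide +kernel)) (by decide)
  have hrank : W.mordellWeilRank + Module.finrank ℚ ℚ + 1 ≤ F.mordellWeilRank := by
    have h2 := two_le_rank_c126350dn1
    have hE : (⟨1, 0, 0, -22988, 2126992⟩ : WeierstrassCurve ℤ).map (Int.castRingHom ℚ) =
        (⟨1, 0, 0, -22988, 2126992⟩ : WeierstrassCurve ℚ) := by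
      ext <;> simp [WeierstrassCurve.map]
    rw [hE] at h2
    rw [(hGZK W (by rw [hr0]; norm_num)).1, hr0, Module.finrank_self, hFeq]
    exact h2
  have hk2 : ∀ w : HeightOneSpectrum (𝓞 ℚ), (primesEquiv w : ℕ) = 2 →
      Nat.card (nsmulAddMonoidHom 5 : (F.baseChange (w.adicCompletion ℚ)).toAffine.Point →+ _).ker = 1 :=
    fun w hw ↦
      natCard_ker_nsmul_five_adicCompletion_eq_one_of_checkAt 2 1 0 0 (-22988) 2126992 (by decide +kernel)
        (k := 6) (cert := []) (by decide +kernel) F hFeq hw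
  have hk5 : ∀ w : HeightOneSpectrum (𝓞 ℚ), (primesEquiv w : ℕ) = 5 →
      Nat.card (nsmulAddMonoidHom 5 : (F.baseChange (w.adicCompletion ℚ)).toAffine.Point →+ _).ker = 1 :=
    fun w hw ↦
      natCard_ker_nsmul_five_adicCompletion_eq_one_of_checkAt 5 1 0 0 (-22988) 2126992 (by decide +kernel)
        (k := 1) (cert := []) (by decide +kernel) F hFeq hw
  have hk19 : ∀ w : HeightOneSpectrum (𝓞 ℚ), (primesEquiv w : ℕ) = 19 →
      Nat.card (nsmulAddMonoidHom 5 : (F.baseChange (w.adicCompletion ℚ)).toAffine.Point →+ _).ker = 1 :=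
    fun w hw ↦
      natCard_ker_nsmul_five_adicCompletion_eq_one_of_checkAt 19 1 0 0 (-22988) 2126992 (by decide +kernel)
        (k := 1) (cert := []) (by decide +kernel) F hFeq hw
  set L : List ℕ := [2, 5, 7, 19] with hL
  have hLp : ∀ r ∈ L, r.Prime := by decide
  have hΔE : ∀ r : ℕ, r.Prime → (r : ℤ) ∣ (⟨1, -1, 1, -1606302780, -24778909622453⟩ : WeierstrassCurve ℤ).Δ → r ∈ L :=
    forall_mem_of_natAbs_eq_prod_pow L [2, 4, 5, 9] hLp (by decide +kernel)
  have hΔF : ∀ r : ℕ, r.Prime → (r : ℤ) ∣ (⟨1, 0, 0, -22988, 2126992⟩ : WeierstrassCurve ℤ).Δ → r ∈ L :=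
    forall_mem_of_natAbs_eq_prod_pow L [14, 4, 5, 3] hLp (by decide +kernel)
  set S : Finset (HeightOneSpectrum (𝓞 ℚ)) :=
    (L.filterMap fun r ↦ if h : r.Prime then some ((primesEquiv (R := 𝓞 ℚ)).symm ⟨r, h⟩) else none).toFinset
    with hSdef
  have hS := good_outside_placesOfList hLp (by decide) _ _ _ _ _ _ _ _ _ _ hΔE hΔF W F hWeq hFeq
  have hplaces : ∀ w ∈ S,
      Nat.card (nsmulAddMonoidHom 5 : (F.baseChange (w.adicCompletion ℚ)).toAffine.Point →+ _).ker = 1 ∨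
      (1 < w.valuation ℚ W.j ∧ 1 < w.valuation ℚ F.j ∧
        (∃ r : w.adicCompletion ℚ, algebraMap ℚ (w.adicCompletion ℚ) (-(W.c₄ / W.c₆)) =
          r ^ 2 * algebraMap ℚ (w.adicCompletion ℚ) (-(F.c₄ / F.c₆))) ∧
        (∀ ζ : w.adicCompletion ℚ, ζ ^ 5 = 1 → ζ = 1)) := by
    intro w hwS
    have hwL : (primesEquiv w : ℕ) ∈ L := (mem_placesOfList_iff hLp w).mp hwS
    have hcases : (primesEquiv w : ℕ) = 2 ∨ (primesEquiv w : ℕ) = 5 ∨ (primesEquiv w : ℕ) = 7 ∨ (primesEquiv w : ℕ) = 19 := by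
      simp only [hL, List.mem_cons, List.mem_nil_iff, or_false] at hwL
      omega
    rcases hcases with hw | hw | hw | hw
    · exact Or.inl (hk2 w hw)
    · exact Or.inl (hk5 w hw)
    · exact Or.inr (kindIIIPrime_v126350do1_at7 W F hWeq hFeq hw)
    · exact Or.inl (hk19 w hw)
  exact missingLower5_of_visible hCT hGZK W hr0 hq hv
    (Summit.BirchSwinnertonDyer.Rank1Residual.X4.exists_sha_ne_zero_of_congr_of_rank_add_of_freePlaces W F hU2
      (by norm_num) θ hθ S hS
      ((natCard_torsionBy_point_eq_of_subsingleton W _ _ _).trans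
        (natCard_torsionBy_eq_one_of_hasIrreducibleModPGaloisRep W 5 hirr)) hrank hplaces)

end Summit.BirchSwinnertonDyer.BirchSwinnertonDyer.Theorems.KTVis

end
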